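import Literature.NumberTheory.Automorphic.LocalComponentGeneric
import HarnessLib

/-!
# Genericity of local components from the zero-detection of continuous cusp forms

Topic `NumberTheory/Automorphic`; proof file (theorems only) on top of `LocalComponentGeneric`, which
constructs the local Whittaker functional of a local component of a cuspidal automorphic
representation `Π ≤ L²_cusp(GL_n(𝔸_K) ⧸ A_G GL_n(K))` (Cogdell, *Analytic theory of L-functions for
GL_n* (2004), §1.2 p. 179: "any Whittaker functional `Λ` on `V_π` determines a family of local
Whittaker functionals `Λ_v`") and reduces the named fact
`Shalika1974_isGeneric_of_hasLocalComponentAt` of `SatakeParameterGenericBound` to the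
zero-detection of the smoothed `L²`-cuspidal vectors `S_η F` by their global Whittaker coefficients
(`isGeneric_of_hasLocalComponentAt_of_zeroDetection`).

Here the hypothesis is rephrased for the tree's **continuous cusp forms** on the automorphic quotient
(`IsContinuousCuspForm` of `GLnCuspidalSpectrum`: continuous, square-integrable, all constant terms
along the maximal standard parabolics vanish), using that smoothed `L²`-cuspidal vectors are such
(`isContinuousCuspForm_smoothedForm` of `SmoothedCuspForms`):

* `isGeneric_of_hasLocalComponentAt_of_cuspFormZeroDetection` — if every non-zero continuous cusp
  form has a non-zero Whittaker coefficient (Tate's character `adeleAddChar K`, a Haar measure on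
  `N_n(𝔸_K)`, Tate's fundamental domain `unipotentTateDomain n K`), every irreducible smooth local
  component at `v` is `ψ_v`-generic;
* `Shalika1974_isGeneric_of_hasLocalComponentAt_of_cuspFormZeroDetection` — hence the named fact in
  rank `n` from that zero-detection in rank `n`: the exact shape in which the discharge will be
  assembled once the Fourier–Whittaker expansion of continuous cusp forms (Cogdell (2004), Thm. 1.1,
  Piatetski-Shapiro and Shalika; in the tree for `n = 2`, `CuspidalWhittakerGL2`, whence
  `Shalika1974_isGeneric_of_hasLocalComponentAt_two` of `LocalComponentGeneric`) is available in every
  rank.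

No definition, no named fact, no local instance is introduced.

## References

* J. W. Cogdell, *Analytic theory of L-functions for GL_n*, in: J. Bernstein, S. Gelbart (eds.),
  *An Introduction to the Langlands Program* (2004), §1.1 Thm. 1.1 (p. 176), §1.2 (p. 179)
  [CogdellAnalyticTheory2004].
-/

noncomputable section

open scoped MatrixGroups
open NumberField IsDedekindDomain MeasureTheory

namespace Literature.NumberTheory.Automorphic

/-! ### The interface with the Fourier expansion of continuous cusp forms -/

section CuspForms

variable {n : ℕ} {K : Type} [Field K] [NumberField K]
  {μ : Measure (AdelicGroupData.gl n K).automorphicQuotient}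
  [(AdelicGroupData.gl n K).IsAutomorphicMeasure μ]

/-- **Local components are generic, given that continuous cusp forms are detected by their
Whittaker coefficients** — the form of `isGeneric_of_hasLocalComponentAt_of_zeroDetection` whose
hypothesis is the printed consequence of the Fourier expansion (Cogdell (2004), Thm. 1.1 p. 176 and
§1.2 p. 179: *"Thus `φ` is completely determined by its associated Whittaker function `W_φ`"*) for
the tree's continuous cusp forms on `GL_n(𝔸_K) ⧸ A_G GL_n(K)` (`IsContinuousCuspForm` of
`GLnCuspidalSpectrum`: continuous, square-integrable, all constant terms along the maximal standard
parabolics vanish): if every non-zero continuous cusp form `Φ` has a non-zero global Whittaker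
coefficient `W_{Φ}(g)` (Tate's character, a Haar measure `ν` on `N_n(𝔸_K)`, Tate's fundamental
domain), then every irreducible smooth local component of a cuspidal `Π` at `v` is `ψ_v`-generic.
The smoothed vectors `S_η F`, `F ∈ L²_cusp`, are continuous cusp forms
(`isContinuousCuspForm_smoothedForm` of `SmoothedCuspForms`). [cite: CogdellAnalyticTheory2004, §1.2 p. 179 (Thm. 1.1 p. 176)] -/
theorem isGeneric_of_hasLocalComponentAt_of_cuspFormZeroDetection
    [MeasurableSpace ↥(adelicUnipotent n K)] [BorelSpace ↥(adelicUnipotent n K)]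
    (ν : Measure ↥(adelicUnipotent n K)) [ν.IsHaarMeasure]
    (hZ : ∀ Φ : (AdelicGroupData.gl n K).automorphicQuotient → ℂ, IsContinuousCuspForm n K μ Φ →
      Φ ≠ 0 → ∃ g : GL (Fin n) (AdeleRing (𝓞 K) K),
        whittakerCoeff ν (unipotentTateDomain n K) (adeleAddChar K)
          (invQuot (AdelicGroupData.gl n K) Φ) g ≠ 0)
    (P : CuspidalAutomorphicRepGL n K μ) (v : HeightOneSpectrum (𝓞 K)) {V : Type*} [AddCommGroup V]
    [Module ℂ V] (ρ : Representation ℂ (GL (Fin n) (v.adicCompletion K)) V) [ρ.IsIrreducible]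
    (hsm : ρ.IsSmooth) (hloc : HasLocalComponentAt P.1 v ρ) :
    IsGeneric ρ ((adeleAddChar K).adicComponent v) :=
  isGeneric_of_hasLocalComponentAt_of_zeroDetection ν
    (fun _ hη hηs _ hF hne => hZ _ (isContinuousCuspForm_smoothedForm hη hηs hF) hne) P v ρ hsm hloc

/-- **The named fact in every rank from the zero-detection of continuous cusp forms.** If, for the
Borel structure of `N_n(𝔸_K)` and a Haar measure `ν`, every non-zero continuous cusp form on
`GL_n(𝔸_K) ⧸ A_G GL_n(K)` has a non-zero Whittaker coefficient (Cogdell (2004), Thm. 1.1, due to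
Piatetski-Shapiro and Shalika (1974); proved in the tree for `n = 2`, cf.
`Shalika1974_isGeneric_of_hasLocalComponentAt_two`), then
`Shalika1974_isGeneric_of_hasLocalComponentAt` holds in rank `n`: the local component is generic for
the local component `ψ_v ≠ 1` of Tate's character (`adicComponent_adeleAddChar_ne_one`). This is the
exact shape in which the discharge `_holds` will be assembled once Thm. 1.1 is available for
continuous cusp forms in every rank. [cite: CogdellAnalyticTheory2004, §1.2 p. 179 (Thm. 1.1 p. 176)] -/
theorem Shalika1974_isGeneric_of_hasLocalComponentAt_of_cuspFormZeroDetection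
    (hZ : ∀ [MeasurableSpace ↥(adelicUnipotent n K)] [BorelSpace ↥(adelicUnipotent n K)]
      (ν : Measure ↥(adelicUnipotent n K)) [ν.IsHaarMeasure]
      (Φ : (AdelicGroupData.gl n K).automorphicQuotient → ℂ), IsContinuousCuspForm n K μ Φ → Φ ≠ 0 →
      ∃ g : GL (Fin n) (AdeleRing (𝓞 K) K),
        whittakerCoeff ν (unipotentTateDomain n K) (adeleAddChar K)
          (invQuot (AdelicGroupData.gl n K) Φ) g ≠ 0) :
    Shalika1974_isGeneric_of_hasLocalComponentAt (n := n) (K := K) (μ := μ) := by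
  intro P v V _ _ ρ _ hadm hloc
  letI : MeasurableSpace ↥(adelicUnipotent n K) := borel _
  haveI : BorelSpace ↥(adelicUnipotent n K) := ⟨rfl⟩
  exact ⟨(adeleAddChar K).adicComponent v,
    (isGlobalAddChar_adeleAddChar K).isContinuousNontrivial_adicComponent
      (adicComponent_adeleAddChar_ne_one v),
    isGeneric_of_hasLocalComponentAt_of_cuspFormZeroDetection (μ := μ) Measure.haar
      (hZ Measure.haar) P v ρ hadm.isSmooth hloc⟩

end CuspForms

end Literature.NumberTheory.Automorphic
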